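import Summits.HubbardSuperconductivity.HubbardSuperconductivity.Theorems.AnisotropyChordTransferFibre3PC0Outer

/-!
# Route `AnisotropyChord` / H0 rotor rung: PartN41-B §6 — the `B_C` OUTER MAJORANT, part 1: per-direction cross bounds
(content version, repaired slope `κ̂′`)

Theory-1 g22's PartN41-B §6 `BCOuterBound` (ported …Fibre3N1Row) with `κ̂′ = kapHat + 2·aPar·cS/V` for `κ̂`:
per momentum `k` off the pair block (`k′ = k + K₁`), with `φ̂ = μ + ρ`, `φ̂′ = μ′ + ρ′`, `F₂ = c + t`, `F₂′ = c′ + t′`: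
`Σ_e bcSummand − [R(c + c′) + M c′] = R(t + t′) + X₁(c + c′ + t + t′) + (S − M)(c′ + t′) + M t′`,
`X₁ = Σ_e Re(conj μ ρ′ + conj ρ μ′ + conj ρ ρ′)` (`|X₁| ≤ D₁`, `BlockCrossTerm` + Young + `Σ_e‖1−z_e‖² = 2E`),
`|R| ≤ Rabs` (★ `abs_RK_le`), and per direction ★ `dir_cross_diff_le` (`BlockCrossTerm` + `cross_poly_bound`); the
per-momentum assembly is in …BCOuter.
Prover seat `hubbard-h0-rotor-p1` g26 (route lead); helper for stmt-HubbardSuperconductivity-23918 (`--supports`, helper class).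
WHAT THIS IS NOT: nothing here proves superconductivity in the Hubbard model; a termwise majorant of ONE row of ONE conditional
reduction.  Tree imports only; no new definitions; no sorry, no axioms.
-/

set_option linter.dupNamespace false
set_option autoImplicit false

noncomputable section

open scoped BigOperators

namespace Summit.HubbardSuperconductivity.HubbardSuperconductivity.Theorems.AnisotropyChord.Transfer.Fibre3

variable (L : ℕ) [NeZero L]

namespace OuterMaj

/-! ## Elementary inequalities -/

omit [NeZero L] in
/-- the per-direction cross polynomial bound (`0 ≤ u, u′ ≤ 2`, `β, β′, q, K, K′, τ ≥ 0`, `m > 0`). [folklore] -/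
theorem cross_poly_bound {u u' β β' q K K' τ m : ℝ} (hu2 : u ≤ 2) (hu2' : u' ≤ 2)
    (hβ : 0 ≤ β) (hβ' : 0 ≤ β') (hq : 0 ≤ q) (hK : 0 ≤ K) (hK' : 0 ≤ K') (hτ : 0 ≤ τ) (hm : 0 < m) :
    (u * β + q) * (u' * K' / 2 + τ / 2) + (u' * β' + q) * (u * K / 2 + τ / 2)
        + (u * K / 2 + τ / 2) * (u' * K' / 2 + τ / 2)
      ≤ (u ^ 2 + u' ^ 2) * (β * K' / 4 + β' * K / 4 + K * K' / 8)
        + τ * (u ^ 2 * β ^ 2 / (4 * m) + m / 4) + τ * (u' ^ 2 * β' ^ 2 / (4 * m) + m / 4)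
        + q * K' + q * K + q * τ + K * τ / 2 + K' * τ / 2 + τ ^ 2 / 4 := by
  have e : (u ^ 2 + u' ^ 2) * (β * K' / 4 + β' * K / 4 + K * K' / 8)
        + τ * (u ^ 2 * β ^ 2 / (4 * m) + m / 4) + τ * (u' ^ 2 * β' ^ 2 / (4 * m) + m / 4)
        + q * K' + q * K + q * τ + K * τ / 2 + K' * τ / 2 + τ ^ 2 / 4
      - ((u * β + q) * (u' * K' / 2 + τ / 2) + (u' * β' + q) * (u * K / 2 + τ / 2)
        + (u * K / 2 + τ / 2) * (u' * K' / 2 + τ / 2))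
      = β * K' * (u - u') ^ 2 / 4 + τ * (u * β - m) ^ 2 / (4 * m) + q * K' * (2 - u') / 2
        + β' * K * (u - u') ^ 2 / 4 + τ * (u' * β' - m) ^ 2 / (4 * m) + q * K * (2 - u) / 2
        + K * K' * (u - u') ^ 2 / 8 + K * τ * (2 - u) / 4 + K' * τ * (2 - u') / 4 := by
    field_simp
    ring
  have h1 : 0 ≤ β * K' * (u - u') ^ 2 / 4 := by positivity
  have h2 : 0 ≤ τ * (u * β - m) ^ 2 / (4 * m) := by positivity
  have h3 : 0 ≤ q * K' * (2 - u') / 2 := by have : 0 ≤ 2 - u' := by linarith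
                                            positivity
  have h4 : 0 ≤ β' * K * (u - u') ^ 2 / 4 := by positivity
  have h5 : 0 ≤ τ * (u' * β' - m) ^ 2 / (4 * m) := by positivity
  have h6 : 0 ≤ q * K * (2 - u) / 2 := by have : 0 ≤ 2 - u := by linarith
                                          positivity
  have h7 : 0 ≤ K * K' * (u - u') ^ 2 / 8 := by positivity
  have h8 : 0 ≤ K * τ * (2 - u) / 4 := by have : 0 ≤ 2 - u := by linarith
                                          positivity
  have h9 : 0 ≤ K' * τ * (2 - u') / 4 := by have : 0 ≤ 2 - u' := by linarith
                                            positivity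
  linarith

/-- `|R(k)| ≤ Rabs(k)` in the regime (`β, β′, q ≥ 0`, `0 ≤ E, E′ ≤ 8`, `0 ≤ ε₁ ≤ 2`). [folklore] -/
theorem abs_RK_le (hL : 5 ≤ L) {Δ : ℝ} (hΔ0 : 0 ≤ Δ) (hΔ1 : Δ < 1) {lam2 : ℝ} {f : Tor L → ℝ}
    (hf : IsGroundTwoMagnon L Δ lam2 f) (k : Tor L) :
    |RK L Δ lam2 f k|
      ≤ betaK L Δ lam2 f k * betaK L Δ lam2 f (k + K1 L) * (EK L k + EK L (k + K1 L) + 2 * eps1 L)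
        + qPar L Δ f / 2 * (betaK L Δ lam2 f k + betaK L Δ lam2 f (k + K1 L)) * (2 * eps1 L + EK L k + EK L (k + K1 L))
        + 4 * qPar L Δ f ^ 2 := by
  obtain ⟨_, _, hq, hβ, _, _⟩ := regime_signs L hL hΔ0 hΔ1 hf k
  obtain ⟨_, _, _, hβ', _, _⟩ := regime_signs L hL hΔ0 hΔ1 hf (k + K1 L)
  have hEb : ∀ p : Tor L, 0 ≤ EK L p ∧ EK L p ≤ 8 := by
    intro p
    unfold EK epsT
    have h1 := Real.cos_le_one (2 * Real.pi * p.1.val / L)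
    have h2 := Real.neg_one_le_cos (2 * Real.pi * p.1.val / L)
    have h3 := Real.cos_le_one (2 * Real.pi * p.2.val / L)
    have h4 := Real.neg_one_le_cos (2 * Real.pi * p.2.val / L)
    constructor <;> linarith
  have he1 : 0 ≤ eps1 L ∧ eps1 L ≤ 2 := by
    unfold eps1
    constructor <;> linarith [Real.cos_le_one (2 * Real.pi / L), Real.neg_one_le_cos (2 * Real.pi / L)]
  obtain ⟨hE0, hE8⟩ := hEb k
  obtain ⟨hE0', hE8'⟩ := hEb (k + K1 L)
  set β := betaK L Δ lam2 f k
  set β' := betaK L Δ lam2 f (k + K1 L)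
  set q := qPar L Δ f
  set E := EK L k
  set E' := EK L (k + K1 L)
  set e1 := eps1 L
  have b1 : |β * β' * (E + E' - 2 * e1)| ≤ β * β' * (E + E' + 2 * e1) := by
    rw [abs_le]; constructor <;>
      nlinarith [mul_nonneg (mul_nonneg hβ hβ') hE0, mul_nonneg (mul_nonneg hβ hβ') hE0',
        mul_nonneg (mul_nonneg hβ hβ') he1.1]
  have b2 : |q / 2 * β * (2 * e1 + E - E')| ≤ q / 2 * β * (2 * e1 + E + E') := by
    rw [abs_le]; constructor <;>
      nlinarith [mul_nonneg (mul_nonneg hq hβ) hE0, mul_nonneg (mul_nonneg hq hβ) hE0',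
        mul_nonneg (mul_nonneg hq hβ) he1.1]
  have b3 : |q / 2 * β' * (2 * e1 - E + E')| ≤ q / 2 * β' * (2 * e1 + E + E') := by
    rw [abs_le]; constructor <;>
      nlinarith [mul_nonneg (mul_nonneg hq hβ') hE0, mul_nonneg (mul_nonneg hq hβ') hE0',
        mul_nonneg (mul_nonneg hq hβ') he1.1]
  have b4 : |q ^ 2 / 4 * (16 - 2 * e1 - E - E')| ≤ 4 * q ^ 2 := by
    rw [abs_le]; constructor <;>
      nlinarith [sq_nonneg q, mul_nonneg (sq_nonneg q) hE0, mul_nonneg (sq_nonneg q) hE0',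
        mul_nonneg (sq_nonneg q) he1.1, mul_nonneg (sq_nonneg q) (by linarith : (0:ℝ) ≤ 8 - E),
        mul_nonneg (sq_nonneg q) (by linarith : (0:ℝ) ≤ 8 - E'), mul_nonneg (sq_nonneg q) (by linarith : (0:ℝ) ≤ 2 - e1)]
  obtain ⟨l1, r1⟩ := abs_le.1 b1
  obtain ⟨l2, r2⟩ := abs_le.1 b2
  obtain ⟨l3, r3⟩ := abs_le.1 b3
  obtain ⟨l4, r4⟩ := abs_le.1 b4
  unfold RK
  rw [abs_le]
  constructor
  · linarith only [l1, r2, r3, l4]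
  · linarith only [r1, l2, l3, r4]

/-! ## The per-direction cross bound -/

/-- per direction `e`: `|Re(conj φ̂_e(k) φ̂_e(k′)) − Re(conj μ_e(k) μ_e(k′))| ≤` the per-direction polynomial of
`cross_poly_bound` in `u = ‖1−z_e(k)‖`, `u′ = ‖1−z_e(k′)‖`. [folklore] -/
theorem dir_cross_diff_le (hL : 5 ≤ L) {Δ : ℝ} (hΔ0 : 0 ≤ Δ) (hΔ1 : Δ < 1) {lam2 : ℝ} {f : Tor L → ℝ}
    (hf : IsGroundTwoMagnon L Δ lam2 f) (M2 : ℕ) (hM : 4 * (M2 + 2) ≤ L) {m0 : ℝ} (hm0 : 0 < m0)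
    (k : Tor L) (hk : k ≠ 0) (hk' : k + K1 L ≠ 0)
    (hfloor : 1 - Real.cos (2 * Real.pi * (M2 + 1) / L) ≤ epsT L k)
    (hfloor' : 1 - Real.cos (2 * Real.pi * (M2 + 1) / L) ≤ epsT L (k + K1 L))
    (e : Tor L) (he : e ∈ nnList L) :
    let K := (kapHat L Δ lam2 f M2 + 2 * aPar L Δ f * cS L Δ lam2 f / (L : ℝ) ^ 2) * gres L lam2 k
    let K' := (kapHat L Δ lam2 f M2 + 2 * aPar L Δ f * cS L Δ lam2 f / (L : ℝ) ^ 2) * gres L lam2 (k + K1 L)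
    let β := betaK L Δ lam2 f k
    let β' := betaK L Δ lam2 f (k + K1 L)
    let q := qPar L Δ f
    let τ := tauBar L Δ lam2 f
    |((starRingEnd ℂ) (phiHat L f e k) * phiHat L f e (k + K1 L)).re
        - ((starRingEnd ℂ) (muK L Δ lam2 f e k) * muK L Δ lam2 f e (k + K1 L)).re|
      ≤ (Complex.normSq (1 - zPh L k e) + Complex.normSq (1 - zPh L (k + K1 L) e)) * (β * K' / 4 + β' * K / 4 + K * K' / 8)
        + τ * (Complex.normSq (1 - zPh L k e) * β ^ 2 / (4 * m0) + m0 / 4)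
        + τ * (Complex.normSq (1 - zPh L (k + K1 L) e) * β' ^ 2 / (4 * m0) + m0 / 4)
        + q * K' + q * K + q * τ + K * τ / 2 + K' * τ / 2 + τ ^ 2 / 4 := by
  dsimp only
  have h0 : 0 < lam2 := lam2_pos L (by omega) hΔ1 hf.1
  obtain ⟨hc, hd, hq, hβ, hg, hτ⟩ := regime_signs L hL hΔ0 hΔ1 hf k
  obtain ⟨_, _, _, hβ', hg', _⟩ := regime_signs L hL hΔ0 hΔ1 hf (k + K1 L)
  set K := (kapHat L Δ lam2 f M2 + 2 * aPar L Δ f * cS L Δ lam2 f / (L : ℝ) ^ 2) * gres L lam2 k with hKdef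
  set K' := (kapHat L Δ lam2 f M2 + 2 * aPar L Δ f * cS L Δ lam2 f / (L : ℝ) ^ 2) * gres L lam2 (k + K1 L)
    with hKdef'
  have ht := tail_slope_abs L hL hΔ0 hΔ1 hf M2 hM k hk hfloor
  have ht' := tail_slope_abs L hL hΔ0 hΔ1 hf M2 hM (k + K1 L) hk' hfloor'
  have hK0 : 0 ≤ K := (abs_nonneg _).trans ht
  have hK0' : 0 ≤ K' := (abs_nonneg _).trans ht'
  set u := ‖(1 : ℂ) - zPh L k e‖ with hu
  set u' := ‖(1 : ℂ) - zPh L (k + K1 L) e‖ with hu'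
  have hu0 : 0 ≤ u := norm_nonneg _
  have hu2 : u ≤ 2 := norm_one_sub_zPh_le L k e
  have hu0' : 0 ≤ u' := norm_nonneg _
  have hu2' : u' ≤ 2 := norm_one_sub_zPh_le L (k + K1 L) e
  have hP : ‖phiHat L f e k - muK L Δ lam2 f e k‖ ≤ u * K / 2 + tauBar L Δ lam2 f / 2 := by
    refine (phiHatNearClosed_holds L hL hΔ0 lam2 f hf h0 e he k hk).trans ?_
    have : ‖(1 : ℂ) - zPh L k e‖ / 2 * |tfun L Δ f k| ≤ u / 2 * K := by
      rw [hu]; exact mul_le_mul_of_nonneg_left ht (by positivity)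
    linarith
  have hP' : ‖phiHat L f e (k + K1 L) - muK L Δ lam2 f e (k + K1 L)‖ ≤ u' * K' / 2 + tauBar L Δ lam2 f / 2 := by
    refine (phiHatNearClosed_holds L hL hΔ0 lam2 f hf h0 e he (k + K1 L) hk').trans ?_
    have : ‖(1 : ℂ) - zPh L (k + K1 L) e‖ / 2 * |tfun L Δ f (k + K1 L)| ≤ u' / 2 * K' := by
      rw [hu']; exact mul_le_mul_of_nonneg_left ht' (by positivity)
    linarith
  have hbc := (blockCrossTerm_holds (phiHat L f e k) (phiHat L f e (k + K1 L)) (muK L Δ lam2 f e k)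
    (muK L Δ lam2 f e (k + K1 L)) _ _ hP hP').1
  have hμ : ‖muK L Δ lam2 f e k‖ ≤ u * betaK L Δ lam2 f k + qPar L Δ f := by
    rw [hu]; have := norm_muK_le L e k hβ hq; linarith
  have hμ' : ‖muK L Δ lam2 f e (k + K1 L)‖ ≤ u' * betaK L Δ lam2 f (k + K1 L) + qPar L Δ f := by
    rw [hu']; have := norm_muK_le L e (k + K1 L) hβ' hq; linarith
  have hPnn : 0 ≤ u * K / 2 + tauBar L Δ lam2 f / 2 := by positivity
  have hPnn' : 0 ≤ u' * K' / 2 + tauBar L Δ lam2 f / 2 := by positivity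
  have hstep : ‖muK L Δ lam2 f e k‖ * (u' * K' / 2 + tauBar L Δ lam2 f / 2)
        + ‖muK L Δ lam2 f e (k + K1 L)‖ * (u * K / 2 + tauBar L Δ lam2 f / 2)
        + (u * K / 2 + tauBar L Δ lam2 f / 2) * (u' * K' / 2 + tauBar L Δ lam2 f / 2)
      ≤ (u * betaK L Δ lam2 f k + qPar L Δ f) * (u' * K' / 2 + tauBar L Δ lam2 f / 2)
        + (u' * betaK L Δ lam2 f (k + K1 L) + qPar L Δ f) * (u * K / 2 + tauBar L Δ lam2 f / 2)
        + (u * K / 2 + tauBar L Δ lam2 f / 2) * (u' * K' / 2 + tauBar L Δ lam2 f / 2) := by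
    nlinarith [mul_le_mul_of_nonneg_right hμ hPnn', mul_le_mul_of_nonneg_right hμ' hPnn]
  have hpoly := cross_poly_bound hu2 hu2' hβ hβ' hq hK0 hK0' hτ hm0
  have hnsq : Complex.normSq (1 - zPh L k e) = u ^ 2 := by rw [hu, Complex.normSq_eq_norm_sq]
  have hnsq' : Complex.normSq (1 - zPh L (k + K1 L) e) = u' ^ 2 := by rw [hu', Complex.normSq_eq_norm_sq]
  rw [hnsq, hnsq']
  calc |((starRingEnd ℂ) (phiHat L f e k) * phiHat L f e (k + K1 L)).re
          - ((starRingEnd ℂ) (muK L Δ lam2 f e k) * muK L Δ lam2 f e (k + K1 L)).re|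
      ≤ ‖muK L Δ lam2 f e k‖ * (u' * K' / 2 + tauBar L Δ lam2 f / 2)
        + ‖muK L Δ lam2 f e (k + K1 L)‖ * (u * K / 2 + tauBar L Δ lam2 f / 2)
        + (u * K / 2 + tauBar L Δ lam2 f / 2) * (u' * K' / 2 + tauBar L Δ lam2 f / 2) := hbc
    _ ≤ _ := hstep
    _ ≤ _ := hpoly
    _ = _ := by ring


end OuterMaj

end Summit.HubbardSuperconductivity.HubbardSuperconductivity.Theorems.AnisotropyChord.Transfer.Fibre3

end
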